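import Summits.Ventures.Crystal3D.Bulk.HexagonTwoRattlers
import Summits.Ventures.Crystal3D.Bulk.GapRattlerSides
import HarnessLib

/-!
# (d3) «AT MOST ONE RATTLER PER p-HEXAGON» and P-L3(h) «AT MOST TWO RATTLERS» on the census
# window `1.25 ≤ D ≤ 1.26` — the census assembly of HEX-PERIMETER (`DESIGN-L12-THEORY.md`
# §P-L3 (d)(h); `phase2/theory1/HEX-PERIMETER.md`)

HONEST FRAMING. Part of the venture `Summits/Ventures/Crystal3D` (cell `pub-crystal3d`, phase 2;
seat typer-bulk-2). Kernel theorem about every configuration satisfying `CensusRows c`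
(`Bulk/GapCensusRows.lean`) with `1.25 ≤ intruderDist c` (the census window; `CensusRows`
carries `intruderDist c ≤ 1.26`, which the hole-edge rattler row needs — red R-40.6: that row
holds iff `D ≤ 1.2611`); nothing is claimed about GAP(1.26). Until now (d3) was the numeric
HEX-PERIMETER premise of the rattler count `r ≤ 2` (`CensusRows.card_rattlers_le_two`,
`Bulk/GapRattlerCount.lean`, hypothesis `hd3`). Here it is discharged:

* `two_caps_perimeter_bound_cw` — the generic adapter: the main metric theorem
  `two_caps_perimeter_bound` (`Bulk/HexagonTwoRattlers.lean`, counter-clockwise window-convex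
  walks) for a periodic CLOCKWISE-convex walk (the census orientation,
  `CensusRows.orient3_oface_neg`; convexity on one period suffices, `convexPos_window`), by
  reversing the walk `i ↦ v (n − 1 − i % n)` (`polyPerim_reverse`, `Bulk/GapRattlerSides.lean`);
  the census-side inputs — insideness along a face walk
  (`CensusRows.orient3_oface_nonneg_of_inCornerFan`) and the per-side rattler rows
  (`CensusRows.inner_rattler_side_le`) — are in `Bulk/GapRattlerSides.lean`;
* **`CensusRows.rattler_hosting_injective`** — exactly the hypothesis `hd3` of
  `CensusRows.card_rattlers_le_two`: two rattlers `j, j'` whose directions lie in the corner fan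
  of the hexagon of the same in-dart `(a, 13)` are equal. Proof: otherwise the face walk
  `t ↦ ĉ_{(φ°^[t] (a,13)).1}` (period `6`, clockwise convex by LEMMA L) with the two unit
  directions inside, the side rows and `⟪ĉ_j, ĉ_{j'}⟫ ≤ 1/2` has perimeter
  `≥ 2 arccos(−17/83) + 2 (√(117/200)·1000/1001) arccos(−5/83)`,
  while its six sides are `ρ, ρ, ≤ 60°, ≤ 60°, ≤ 60°, ≤ 60°` with `ρ = arccos (D/2) ≤ arccos (5/8)`,
  total `≤ 4π/3 + 2 arccos (5/8)` — contradicting `two_caps_gt`;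
* **`CensusRows.card_rattlers_le_two_window`** — P-L3(h) UNCONDITIONALLY on the window: a census
  configuration with `1.25 ≤ intruderDist c` has at most two rattlers
  (`CensusRows.card_rattlers_le_two` of `Bulk/GapRattlerCount.lean` — (d1)(d2) hosting by p3's
  `Bulk/GapRattlerHosting.lean` and the hexagon packing `4·#H + #R ≤ 12` of
  `Bulk/GapHexagonPacking.lean` — with its hypothesis `hd3` discharged by the previous theorem).
-/

noncomputable section

namespace Summit.Ventures.Crystal3D

open Literature.Geometry.DiscreteGeometry Finset Equiv HullRotSys Function Real InnerProductGeometry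
open scoped InnerProductSpace RealInnerProductSpace

/-! ## The main metric theorem for a clockwise walk (generic adapter) -/

/-- **Main metric theorem of (d3), clockwise form.** For a periodic walk `v` (period `n ≥ 3`)
whose vertices within a period are clockwise convex (`orient3 vᵢ vⱼ v_k < 0`, `i < j < k < n`),
two unit vectors `z₁, z₂` inside (`0 ≤ orient3 v_{t+1} v_t z`) with the per-side rattler rows
and `⟪z₁, z₂⟫ ≤ 1/2` force perimeter `≥ 2 arccos(−17/83) + 2 (√(117/200)·1000/1001) arccos(−5/83)`. -/
theorem two_caps_perimeter_bound_cw {n : ℕ} {v : ℕ → EuclideanSpace ℝ (Fin 3)} (hn : 3 ≤ n)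
    (hper : ∀ i, v (i + n) = v i)
    (hcw : ∀ i j k, i < j → j < k → k < n → orient3 (v i) (v j) (v k) < 0)
    {z₁ z₂ : EuclideanSpace ℝ (Fin 3)} (hz₁ : ‖z₁‖ = 1) (hz₂ : ‖z₂‖ = 1)
    (hin₁ : ∀ t, 0 ≤ orient3 (v (t + 1)) (v t) z₁) (hin₂ : ∀ t, 0 ≤ orient3 (v (t + 1)) (v t) z₂)
    (hseg₁ : ∀ t, ∀ a b : ℝ, 0 ≤ a → 0 ≤ b →
      ⟪z₁, a • v t + b • v (t + 1)⟫ ≤ Real.sqrt (83 / 200) * ‖a • v t + b • v (t + 1)‖)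
    (hseg₂ : ∀ t, ∀ a b : ℝ, 0 ≤ a → 0 ≤ b →
      ⟪z₂, a • v t + b • v (t + 1)⟫ ≤ Real.sqrt (83 / 200) * ‖a • v t + b • v (t + 1)‖)
    (h12 : ⟪z₁, z₂⟫ ≤ 1 / 2) :
    2 * arccos (-17 / 83 : ℝ) + 2 * (Real.sqrt (117 / 200) * 1000 / 1001) * arccos (-5 / 83 : ℝ) ≤
      polyPerim v n := by
  obtain ⟨w, hw⟩ : ∃ w : ℕ → EuclideanSpace ℝ (Fin 3), ∀ i, w i = v (n - 1 - i % n) :=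
    ⟨_, fun _ => rfl⟩
  have hn0 : 0 < n := by omega
  have hperw : ∀ i, w (i + n) = w i := fun i => by rw [hw, hw, Nat.add_mod_right]
  -- every side of `w` is a side of `v`, reversed
  have hedge : ∀ i, ∃ s, w i = v (s + 1) ∧ w (i + 1) = v s := by
    intro i
    have hlt : i % n < n := Nat.mod_lt _ hn0
    rcases Nat.lt_or_ge (i % n) (n - 1) with h | h
    · refine ⟨n - 2 - i % n, ?_, ?_⟩
      · rw [hw]; congr 1; omega
      · have h1 : (i + 1) % n = i % n + 1 := by
          rw [Nat.add_mod i 1 n, Nat.mod_eq_of_lt (by omega : 1 < n),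
            Nat.mod_eq_of_lt (by omega : i % n + 1 < n)]
        rw [hw, h1]; congr 1; omega
    · have hi : i % n = n - 1 := by omega
      refine ⟨n - 1, ?_, ?_⟩
      · rw [hw, hi, Nat.sub_self, ← hper 0, zero_add, Nat.sub_add_cancel (by omega : 1 ≤ n)]
      · have h1 : (i + 1) % n = 0 := by
          rw [Nat.add_mod i 1 n, hi, Nat.mod_eq_of_lt (by omega : 1 < n),
            Nat.sub_add_cancel (by omega : 1 ≤ n), Nat.mod_self]
        rw [hw, h1, Nat.sub_zero]
  have hcxw : ∀ i j k, i < j → j < k → k < i + n → 0 < orient3 (w i) (w j) (w k) := by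
    refine convexPos_window hn hperw fun i j k hij hjk hk => ?_
    rw [hw, hw, hw, Nat.mod_eq_of_lt (by omega : i < n), Nat.mod_eq_of_lt (by omega : j < n),
      Nat.mod_eq_of_lt hk]
    have := hcw (n - 1 - k) (n - 1 - j) (n - 1 - i) (by omega) (by omega) (by omega)
    rw [orient3_swap_outer]; linarith
  have hinw : ∀ z : EuclideanSpace ℝ (Fin 3), (∀ t, 0 ≤ orient3 (v (t + 1)) (v t) z) →
      ∀ i, 0 ≤ orient3 (w i) (w (i + 1)) z := by
    intro z hin i
    obtain ⟨s, h1, h2⟩ := hedge i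
    rw [h1, h2]; exact hin s
  have hsegw : ∀ z : EuclideanSpace ℝ (Fin 3), (∀ t, ∀ a b : ℝ, 0 ≤ a → 0 ≤ b →
      ⟪z, a • v t + b • v (t + 1)⟫ ≤ Real.sqrt (83 / 200) * ‖a • v t + b • v (t + 1)‖) →
      ∀ i, ∀ a b : ℝ, 0 ≤ a → 0 ≤ b →
        ⟪z, a • w i + b • w (i + 1)⟫ ≤ Real.sqrt (83 / 200) * ‖a • w i + b • w (i + 1)‖ := by
    intro z hseg i a b ha hb
    obtain ⟨s, h1, h2⟩ := hedge i
    rw [h1, h2, add_comm (a • v (s + 1))]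
    exact hseg s b a hb ha
  have hmain := two_caps_perimeter_bound hn hperw hcxw hz₁ hz₂ (hinw z₁ hin₁) (hinw z₂ hin₂)
    (hsegw z₁ hseg₁) (hsegw z₂ hseg₂) h12
  have hwf : w = fun i => v (n - 1 - i % n) := funext hw
  rwa [hwf, polyPerim_reverse v (by omega) hper] at hmain

/-! ## The census assembly -/

variable {c : Fin 14 → EuclideanSpace ℝ (Fin 3)}

/-- `arccos (1/2) = π/3`, inlined. -/
private theorem arccos_half'' : arccos (1 / 2 : ℝ) = π / 3 := by
  rw [← Real.cos_pi_div_three, Real.arccos_cos (by positivity) (by linarith [Real.pi_pos])]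

/-- **(d3) «at most one rattler per `p`-hexagon» on the census window** — the hypothesis `hd3`
of `CensusRows.card_rattlers_le_two` (`Bulk/GapRattlerCount.lean`), discharged: if the
directions of two rattlers `j, j'` both lie in the corner fan of the oriented face of the in-dart
`(a, 13)` of a `p`-hexagon, then `j = j'`. -/
theorem CensusRows.rattler_hosting_injective (h : CensusRows c) (hD : (1.25 : ℝ) ≤ intruderDist c)
    (j j' : Fin 14) (hj0 : j ≠ 0) (hj13 : j ≠ 13) (hj : j ∉ activeVertices c) (hj'0 : j' ≠ 0)
    (hj'13 : j' ≠ 13) (hj' : j' ∉ activeVertices c) (a : Fin 14) (ha : a ∈ tightNbrs c 13)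
    (h6 : ofaceLen c (a, 13) = 6)
    (hfan : InCornerFan h.isGapConfig.norm_of_mem_activeDirSet
      h.zero_mem_interior_convexHull_activeDirSet (tightDartsIn c (activeDirSet c))
      ⟨dirPair c (a, 13), h.dirPair_mem_hullDarts_active _
        (swap_mem_darts (mk_mem_darts (by decide) ha))⟩ (gapDir c j))
    (hfan' : InCornerFan h.isGapConfig.norm_of_mem_activeDirSet
      h.zero_mem_interior_convexHull_activeDirSet (tightDartsIn c (activeDirSet c))
      ⟨dirPair c (a, 13), h.dirPair_mem_hullDarts_active _
        (swap_mem_darts (mk_mem_darts (by decide) ha))⟩ (gapDir c j')) :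
    j = j' := by
  by_contra hne
  set q : Fin 14 × Fin 14 := (a, 13) with hqdef
  have hq : q ∈ darts c := swap_mem_darts (mk_mem_darts (by decide) ha)
  -- rattler hypotheses
  have hratt : ∀ k : Fin 14, k ≠ 0 → k ≠ j → dist (c j) (c k) ≠ 1 := fun k hk0 hkj hd =>
    hj (mem_activeVertices.2 ⟨hj0, ⟨k, mem_tightNbrs.2 ⟨hk0, hkj, hd⟩⟩⟩)
  have hratt' : ∀ k : Fin 14, k ≠ 0 → k ≠ j' → dist (c j') (c k) ≠ 1 := fun k hk0 hkj hd =>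
    hj' (mem_activeVertices.2 ⟨hj'0, ⟨k, mem_tightNbrs.2 ⟨hk0, hkj, hd⟩⟩⟩)
  -- the walk
  obtain ⟨v, hv⟩ : ∃ v : ℕ → EuclideanSpace ℝ (Fin 3), ∀ t, v t = gapDir c ((ofaceSucc c)^[t] q).1 :=
    ⟨_, fun _ => rfl⟩
  have hper : ∀ t, v (t + 6) = v t := fun t => by
    rw [hv, hv, iterate_add_apply, ← h6, iterate_ofaceLen]
  have hcw : ∀ i j k, i < j → j < k → k < 6 → orient3 (v i) (v j) (v k) < 0 := by
    intro i j k hij hjk hk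
    rw [hv, hv, hv]; exact h.orient3_oface_neg hq hij hjk (by rw [h6]; exact hk)
  have hz₁ : ‖gapDir c j‖ = 1 := h.isGapConfig.norm_gapDir hj0
  have hz₂ : ‖gapDir c j'‖ = 1 := h.isGapConfig.norm_gapDir hj'0
  have hin₁ : ∀ t, 0 ≤ orient3 (v (t + 1)) (v t) (gapDir c j) := fun t => by
    rw [hv, hv]; exact h.orient3_oface_nonneg_of_inCornerFan hq hfan t
  have hin₂ : ∀ t, 0 ≤ orient3 (v (t + 1)) (v t) (gapDir c j') := fun t => by
    rw [hv, hv]; exact h.orient3_oface_nonneg_of_inCornerFan hq hfan' t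
  have hseg₁ : ∀ t, ∀ a b : ℝ, 0 ≤ a → 0 ≤ b → ⟪gapDir c j, a • v t + b • v (t + 1)⟫ ≤
      Real.sqrt (83 / 200) * ‖a • v t + b • v (t + 1)‖ := fun t a b ha hb => by
    rw [hv, hv]; exact h.inner_rattler_side_le hq hj0 hj13 hratt t ha hb
  have hseg₂ : ∀ t, ∀ a b : ℝ, 0 ≤ a → 0 ≤ b → ⟪gapDir c j', a • v t + b • v (t + 1)⟫ ≤
      Real.sqrt (83 / 200) * ‖a • v t + b • v (t + 1)‖ := fun t a b ha hb => by
    rw [hv, hv]; exact h.inner_rattler_side_le hq hj'0 hj'13 hratt' t ha hb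
  have h12 : ⟪gapDir c j, gapDir c j'⟫ ≤ 1 / 2 := by
    have := h.isGapConfig.inner_gapDir_le hj0 hj'0 hne
    rwa [tightLevel_of_ne hj13 hj'13] at this
  have hbound := two_caps_perimeter_bound_cw (by norm_num) hper hcw hz₁ hz₂ hin₁ hin₂ hseg₁ hseg₂ h12
  -- the six sides: `ρ, ρ` at the hole and four sides `≤ π/3`
  have hdart : ∀ t, (ofaceSucc c)^[t] q ∈ darts c := fun t => h.iterate_ofaceSucc_mem_darts hq t
  have hv1 : ∀ t, ‖v t‖ = 1 := fun t => by rw [hv]; exact h.isGapConfig.norm_gapDir (mem_darts.1 (hdart t)).1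
  have hside : ∀ t, angle (v t) (v (t + 1)) =
      arccos (tightLevel c ((ofaceSucc c)^[t] q).1 ((ofaceSucc c)^[t] q).2) := by
    intro t
    rw [angle_eq_arccos_inner_of_norm_one (hv1 t) (hv1 (t + 1)), hv, hv, fst_iterate_succ]
    obtain ⟨h1, h2, -, hd⟩ := mem_darts.1 (hdart t)
    rw [h.isGapConfig.inner_gapDir_eq h1 h2 hd]
  have hside_le : ∀ t, angle (v t) (v (t + 1)) ≤ π / 3 := by
    intro t; rw [hside t, ← arccos_half'']
    exact Real.arccos_le_arccos (h.isGapConfig.half_le_tightLevel _ _)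
  have hρ : arccos (intruderDist c / 2) ≤ arccos (5 / 8) := by
    apply Real.arccos_le_arccos; norm_num at hD ⊢; linarith
  have hs0 : angle (v 0) (v 1) ≤ arccos (5 / 8) := by
    rw [hside 0, iterate_zero, id_eq, tightLevel_of_right]; exact hρ
  have hs1 : angle (v 1) (v (1 + 1)) ≤ arccos (5 / 8) := by
    rw [hside 1]
    have : ((ofaceSucc c)^[1] q).1 = 13 := by rw [fst_iterate_succ]; rfl
    rw [this, tightLevel_of_left]; exact hρ
  have hperim : polyPerim v 6 ≤ 4 * π / 3 + 2 * arccos (5 / 8 : ℝ) := by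
    unfold polyPerim
    simp only [Finset.sum_range_succ, Finset.sum_range_zero, zero_add]
    linarith [hside_le 2, hside_le 3, hside_le 4, hside_le 5]
  linarith [two_caps_gt]

/-- **P-L3(h) on the census window: at most two rattlers.** A census configuration with
`1.25 ≤ intruderDist c` has at most `2` shell balls without a tight partner
(`CensusRows.card_rattlers_le_two` with (d3) discharged by `CensusRows.rattler_hosting_injective`). -/
theorem CensusRows.card_rattlers_le_two_window (h : CensusRows c) (hD : (1.25 : ℝ) ≤ intruderDist c) :
    (univ.filter fun j : Fin 14 => j ≠ 0 ∧ j ≠ 13 ∧ j ∉ activeVertices c).card ≤ 2 :=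
  h.card_rattlers_le_two (h.rattler_hosting_injective hD)

end Summit.Ventures.Crystal3D

end
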